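import Literature.AlgebraicGeometry.ComplexMultiplication.RationalRepresentationRank
import Literature.RingTheory.SimpleModule.BlockModuleOfFaithfulRepresentation
import HarnessLib

/-!
# The block module of `End⁰_E(B)` at an idempotent (the S2′ `SocketBetti`, Hecke-free)
# (Shimura 1998 §5.1; Lang VII §2 Thm. 2.1; Mumford §19 Thm. 3)

Layer `Literature/AlgebraicGeometry/ComplexMultiplication`, namespace `Literature.AlgebraicGeometry.ComplexMultiplication`.

Composition of three tree files: the faithful rational representation `ψ : End⁰_E(B) → M_{2 dim B}(ℚ)` with its `ℓ`-adic comparisons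
(`RationalRepresentationTateComparison.exists_ratRep_tateComparison`) and rank dictionary (`RationalRepresentationRank.rank_eq_two_mul_dim_image`:
`rank ψ(e) = 2 dim(Im u)` for honest quasi-idempotents), and the block module of a faithful matrix representation
(`RingTheory.SimpleModule.exists_blockModule_of_matrixRep`).  Result `exists_ratRep_blockModule_of_numberField`: for `H ⊆ End⁰_E(B)`,
`ε ∈ H` a non-zero idempotent commuting with `H`, and a block field `φ : R₀ → Z(H)·ε`, the CONCRETE block `V = range (ψ ε *ᵥ ·) ⊆ ℚ^ι`
is a finite `R₀`-vector space and a faithful `εH`-module by `R₀`-linear operators in which `2 dim(Im u) = dim_ℚ range(act h)` whenever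
`u² = a u`, `a ≠ 0`, `1 ⊗ u = a • h`, `ε h = h` — with `ψ`, `ι` and the comparisons `c` EXPOSED (so that an `ℓ`-adic dimension identity
can be transported onto `V` and `act.range`).

USE (cell `hodgecm-mathlib`, D-0151, crux `HLiu418` = stmt-HodgeConjecture-24832, d6 card S2′): `SocketBetti` (minus `hdim`) of the
(α″) assembly probe (A-p11), and the model `(ψ, ι, V ⊆ ℚ^ι, act, c)` on which the (D3) dimension-identity transport is instantiated.
-/

noncomputable section

open CategoryTheory Module Function
open scoped Matrix
open Literature.AlgebraicGeometry.Motives Literature.AlgebraicGeometry.Motives.AbelianVariety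
open Literature.RingTheory.SimpleModule

namespace Literature.AlgebraicGeometry.ComplexMultiplication

/-- **The block module of `End⁰_E(B)` at an idempotent, over a number field** ((D2)+(D2c)+(D4) composed, Hecke-free, nothing hidden):
for `B` an abelian variety over a number field `E`, `H ⊆ End⁰_E(B)` a subalgebra, `ε ∈ H` a non-zero idempotent commuting with `H`, and a
block field `φ : R₀ → H` (`ℚ`-linear, multiplicative, `φ 1 = ε`, central in `H`): there is a faithful rational representation
`ψ : End⁰_E(B) → M_ι(ℚ)`, `#ι = 2 dim B`, with its `ℓ`-adic comparisons `c : ℚ_ℓ^ι ≃ V_ℓ(B)` (`c ∘ (ψ x)_ℓ = V_ℓ(x) ∘ c`, every `ℓ`),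
such that the CONCRETE block `V := range (ψ ε *ᵥ ·) ⊆ ℚ^ι` is a finite `R₀`-vector space (`(r • v : ℚ^ι) = ψ(φ r) *ᵥ v`), non-zero, and
an `H`-module through a `ℚ`-algebra homomorphism `act : H → End_ℚ(V)` (`(act h v : ℚ^ι) = ψ h *ᵥ v`) by `R₀`-LINEAR operators, with
`act (φ r) = (r • ·)`, faithful on `εH` (`act h = 0 ↔ ε h = 0`), in which every honest quasi-idempotent reads its image:
`2 · dim(Im u) = dim_ℚ range (act h)` for `u² = a u`, `a ≠ 0`, `ε h = h`, `1 ⊗ u = a • h`.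
(`ψ`, `c`: `RationalRepresentationTateComparison.exists_ratRep_tateComparison`; block: `RingTheory.SimpleModule.exists_blockModule_of_matrixRep`;
ranks: `RationalRepresentationRank.rank_eq_two_mul_dim_image` at `ℓ = 2`.)
[cite: Shimura1998, §5.1 Proposition 1 (p. 36) and Propositions 3–4 (p. 37)] [cite: Lang1982AbelianFunctions, Ch. VII §2, Thm. 2.1, p. 116]
[cite: MumfordAV1970, §19 Thm. 3 (p. 176)] -/
theorem exists_ratRep_blockModule_of_numberField {E : Type} [Field E] [NumberField E] (B : AbelianVariety E)
    (H : Subalgebra ℚ B.endAlgebra) {ε : B.endAlgebra} (hεH : ε ∈ H) (hε : IsIdempotentElem ε) (hε0 : ε ≠ 0)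
    (hεc : ∀ h ∈ H, ε * h = h * ε) {R₀ : Type} [Field R₀] [NumberField R₀] (φ : R₀ →ₗ[ℚ] B.endAlgebra)
    (hφmul : ∀ a b, φ (a * b) = φ a * φ b) (hφ1 : φ 1 = ε) (hφH : ∀ r, φ r ∈ H)
    (hφc : ∀ r, ∀ h ∈ H, φ r * h = h * φ r) :
    ∃ (ι : Type) (_ : Fintype ι) (_ : DecidableEq ι) (ψ : B.endAlgebra →ₐ[ℚ] Matrix ι ι ℚ),
      Injective ψ ∧ Fintype.card ι = 2 * B.dim ∧
      (∀ (ℓ : ℕ) [Fact ℓ.Prime], ∃ c : (ι → ℚ_[ℓ]) ≃ₗ[ℚ_[ℓ]] B.rationalTateModule ℓ, ∀ x : B.endAlgebra,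
        (c : (ι → ℚ_[ℓ]) →ₗ[ℚ_[ℓ]] B.rationalTateModule ℓ) ∘ₗ Matrix.mulVecLin ((ψ x).map (algebraMap ℚ ℚ_[ℓ])) =
          (rationalTateAction B ℓ x : Module.End ℚ_[ℓ] (B.rationalTateModule ℓ)) ∘ₗ
            (c : (ι → ℚ_[ℓ]) →ₗ[ℚ_[ℓ]] B.rationalTateModule ℓ)) ∧
      ∃ (_ : Module R₀ ↥(LinearMap.range (Matrix.mulVecLin (ψ ε))))
        (_ : IsScalarTower ℚ R₀ ↥(LinearMap.range (Matrix.mulVecLin (ψ ε))))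
        (_ : Module.Finite R₀ ↥(LinearMap.range (Matrix.mulVecLin (ψ ε))))
        (_ : Nontrivial ↥(LinearMap.range (Matrix.mulVecLin (ψ ε))))
        (act : ↥H →ₐ[ℚ] Module.End ℚ ↥(LinearMap.range (Matrix.mulVecLin (ψ ε)))),
        (∀ (h : H) (v : LinearMap.range (Matrix.mulVecLin (ψ ε))),
            ((act h v : LinearMap.range (Matrix.mulVecLin (ψ ε))) : ι → ℚ) = ψ h *ᵥ (v : ι → ℚ)) ∧
        (∀ (r : R₀) (v : LinearMap.range (Matrix.mulVecLin (ψ ε))),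
            ((r • v : LinearMap.range (Matrix.mulVecLin (ψ ε))) : ι → ℚ) = ψ (φ r) *ᵥ (v : ι → ℚ)) ∧
        (∀ (h : H) (r : R₀) (v : LinearMap.range (Matrix.mulVecLin (ψ ε))), act h (r • v) = r • act h v) ∧
        (∀ (r : R₀) (v : LinearMap.range (Matrix.mulVecLin (ψ ε))), act ⟨φ r, hφH r⟩ v = r • v) ∧
        (∀ h : H, act h = 0 ↔ ε * (h : B.endAlgebra) = 0) ∧
        ∀ (h : H) (u : B ⟶ B) (a : ℕ), u ≫ u = a • u → a ≠ 0 → ε * (h : B.endAlgebra) = h →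
          AbelianVariety.endAlgebra.of B u = (a : ℚ) • (h : B.endAlgebra) →
            2 * (AbelianVariety.image u).dim =
              Module.finrank ℚ ↥(LinearMap.range (act h)) := by
  classical
  obtain ⟨ι, _, _, ψ, hψ, hcard, hcmp⟩ := exists_ratRep_tateComparison B
  haveI : Fact (Nat.Prime 2) := ⟨Nat.prime_two⟩
  obtain ⟨c, hc⟩ := hcmp 2
  have h2 : ((2 : ℕ) : E) ≠ 0 := by exact_mod_cast (two_ne_zero : (2 : E) ≠ 0)
  obtain ⟨modZ, hST, hfin, act, hact, hsmul, hHZ, hφact, hker, hnt, hrk⟩ :=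
    exists_blockModule_of_matrixRep ψ H hψ hεH hε hεc φ hφmul hφ1 hφH hφc
  refine ⟨ι, inferInstance, inferInstance, ψ, hψ, hcard, fun ℓ _ ↦ hcmp ℓ, modZ, hST, hfin, hnt hε0, act, hact, hsmul, hHZ,
    hφact, hker, fun h u a hu ha hεh he ↦ ?_⟩
  rw [hrk h, hεh]
  exact (rank_eq_two_mul_dim_image B ψ 2 c hc h2 hu ha he).symm

end Literature.AlgebraicGeometry.ComplexMultiplication

end
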